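import Literature.NumberTheory.LFunctions.SchoenfeldZeroSumsExplicit
import Literature.NumberTheory.LFunctions.SchoenfeldPiIntegral
import HarnessLib

/-!
# Schoenfeld's bound for `x ≥ 10⁸` under RH: the explicit majorants and the final inequality

Topic: `Literature/NumberTheory/LFunctions`. THEOREMS (everything proved; a few `decide +kernel`
evaluations of the tree's logarithm enclosure `KernelLog.logIv`). Numerical half of the analytic
range `x ≥ 10⁸` in the discharge of `Literature.NumberTheory.LFunctions.schoenfeld_explicit` (Schoenfeld 1976, Cor. 1).
With `s = √x`, `ℓ = log x`, the height `T = 5s/11` and the step `h = 5s` in the differenced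
explicit formula (`SchoenfeldPsiDifference.lean`), the closed forms of
`SchoenfeldZeroSumsExplicit.lean` give the majorant

  `E⁻(x) = 5s/2 + log 2π + s·(log²(T/2π)/(2π) + C₁) + (4x/5)·G(T) ≥ x − ψ(x)`

(`Eminus`), and `SchoenfeldPiIntegral.lean` gives the majorants `IpsiB x` of
`|∫_{10⁴}^x (ψ − t) dt/(t log² t)|` and `1.33·Kbnd x` of `∫_{10⁴}^x (ψ − θ) dt/(t log² t)`
(`Kbnd` bounds `∫_{10⁴}^x dt/(√t log² t)` by `g₁(t) = 2√t/log²t + 8√t/log³t`,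
`g₁' = (1 − 24/log²t)/(√t log²t)`, on `[10⁴,10⁶]`, `[10⁶,10⁸]`, `[10⁸,x]`). The main result is the
elementary inequality behind Cor. 1 on `[10⁸, ∞)`:

* `key_ineq` — for `x ≥ 10⁸`,
  **`E⁻(x) + 1.0925 s + ℓ·(IpsiB x + 1.33 Kbnd x + 25/π) < s ℓ²/(8π)`**.

Proof: expanding, `E⁻(x) = sℓ²/(8π) + (λ₀/(2π) + 11/(25π)) sℓ + … ` with
`λ₀ = log(5/11) − log 2π = −2.6263…` (`Eminus_eq`); every coefficient is majorised numerically
(`log 2, log 5, log 10, log 11, log π, log 2516` from Mathlib / `KernelLog.logIv`; `C₁ ≤ 0.041`), giving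
`LHS ≤ sℓ²/(8π) − 0.27657 sℓ + 4.2775 s + 2.912 s/ℓ + 11.46 s/ℓ² + 39.95 ℓ + 242.1 + 5.3/s`; since
`ℓ ≥ log 10⁸`, `s ≥ 10⁴` and `ℓ/s` is non-increasing, the right side is `≤ sℓ²/(8π) − 0.52 s`.
(In the units of the header of `SchoenfeldPsiDifference.lean` this is a margin of `≈ 0.7` in the
constant `c` of `|ψ(x) − x| ≤ √x log x (log x − c)/(8π)`.)

## References

* L. Schoenfeld, Math. Comp. 30 (1976), 337–360, Thm. 10 and Cor. 1. [Schoenfeld1976]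
-/

noncomputable section

open Real MeasureTheory Set intervalIntegral
open scoped Chebyshev

namespace Literature.NumberTheory.LFunctions

namespace SchoenfeldBound

open Literature.Analysis.SpecialFunctions.KernelLog

/-! ### Logarithms of a few constants -/

/-- `2.3025850929 < log 10 < 2.3025850930` (kernel enclosure; one more digit than what `Real.log_ten_eq` with
Mathlib's `d9` bounds for `log 2`, `log 5` gives — kept for uniformity with the other `logIv` constants of
this file; `log 5` itself is taken from Mathlib's `Real.log_five_gt_d9` / `Real.log_five_lt_d9`). [folklore] -/
theorem log_ten_bounds : (2.3025850929 : ℝ) < Real.log 10 ∧ Real.log 10 < 2.302585093 := by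
  have h : logIv 10 = some (2783654570780016011168420, 2783654570780491616991106) := by decide +kernel
  have := logIv_sound h
  norm_num at this ⊢
  constructor <;> linarith [this.1, this.2]

/-- `2.397895272 < log 11 < 2.397895273` (kernel enclosure). [folklore] -/
theorem log_eleven_bounds : (2.397895272 : ℝ) < Real.log 11 ∧ Real.log 11 < 2.397895273 := by
  have h : logIv 11 = some (2898877508017578593179883, 2898877508018054199050927) := by decide +kernel
  have := logIv_sound h
  norm_num at this ⊢
  constructor <;> linarith [this.1, this.2]

/-- `7.8304256 < log 2516 < 7.8304257` (kernel enclosure). [folklore] -/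
theorem log_2516_bounds : (7.8304256 : ℝ) < Real.log 2516 ∧ Real.log 2516 < 7.8304257 := by
  have h : logIv 2516 = some (9466403707954595054280060, 9466403707955070660489610) := by decide +kernel
  have := logIv_sound h
  norm_num at this ⊢
  constructor <;> linarith [this.1, this.2]

/-- `log π < 1.1447299` (`π < 3.14159265358979323847`, kernel enclosures). [folklore] -/
theorem log_pi_lt_d8 : Real.log π < 1.1447299 := by
  have h1 : logIv 314159265358979323847 = some (57056984931092685518384384, 57056984931093161127350340) := by
    decide +kernel
  have hA := (logIv_sound h1).2
  have hB := log_ten_bounds.1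
  simp only [Nat.cast_ofNat] at hA
  have hπ := Real.pi_lt_d20
  have hlog : Real.log π ≤ Real.log (314159265358979323847 : ℝ) - 20 * Real.log 10 := by
    have e : (314159265358979323847 : ℝ) = 3.14159265358979323847 * (10 : ℝ) ^ 20 := by norm_num
    rw [e, Real.log_mul (by norm_num) (by norm_num), Real.log_pow]
    push_cast
    have := Real.log_le_log Real.pi_pos hπ.le
    linarith
  norm_num at hA ⊢
  linarith

/-- `1.8378770 < log 2π < 1.8378772`. [folklore] -/
theorem log_two_pi_bounds : (1.837877 : ℝ) < Real.log (2 * π) ∧ Real.log (2 * π) < 1.8378772 := by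
  rw [Real.log_mul two_ne_zero Real.pi_ne_zero]
  have := Real.log_two_gt_d9
  have := Real.log_two_lt_d9
  have := log_pi_gt_d8
  have := log_pi_lt_d8
  constructor <;> linarith

/-- `λ₀ = log(5/11) − log 2π = log(5/(22π))`, so that `log(T/2π) = ½ log x + λ₀` for `T = 5√x/11`. [folklore] -/
def lam0 : ℝ := Real.log (5 / 11) - Real.log (2 * π)

/-- `−2.6264 < λ₀ < −2.62633`. [folklore] -/
theorem lam0_bounds : (-2.6264 : ℝ) < lam0 ∧ lam0 < -2.62633 := by
  unfold lam0
  rw [Real.log_div (by norm_num) (by norm_num)]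
  have := Real.log_five_gt_d9
  have := Real.log_five_lt_d9
  have := log_eleven_bounds
  have := log_two_pi_bounds
  constructor <;> linarith

/-- `−0.78846 < log(5/11) < −0.788457`. [folklore] -/
theorem log_five_elevenths_bounds : (-0.78846 : ℝ) < Real.log (5 / 11) ∧ Real.log (5 / 11) < -0.788457 := by
  rw [Real.log_div (by norm_num) (by norm_num)]
  have := Real.log_five_gt_d9
  have := Real.log_five_lt_d9
  have := log_eleven_bounds
  constructor <;> linarith

/-- **`C₁ ≤ 0.041`** (`C₁ = 5.681 − 2F_a(2516) − (1 + log 2π)/π − log²(2π)/(2π) = 0.0400…`). [folklore] -/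
theorem C1_le : C1 ≤ 0.041 := by
  have hπ := Real.pi_gt_d6
  have hπ' := Real.pi_lt_d6
  obtain ⟨hl, hl'⟩ := log_2516_bounds
  obtain ⟨hL, hL'⟩ := log_two_pi_bounds
  -- `F_a(2516) ≥ 2.0996`
  have hFa : 2.0996 ≤ Fa 2516 := by
    unfold Fa
    have hl2 : (7.8304256 : ℝ) ^ 2 ≤ Real.log 2516 ^ 2 := pow_le_pow_left₀ (by norm_num) hl.le 2
    have h1 : (4.8793 : ℝ) ≤ Real.log 2516 ^ 2 / (4 * π) := by
      rw [le_div_iff₀ (by positivity)]; nlinarith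
    have h2 : (1 + Real.log (2 * π)) / (2 * π) * Real.log 2516 ≤ 3.53672 := by
      rw [div_mul_eq_mul_div, div_le_iff₀ (by positivity)]; nlinarith
    have h3 : (7 / 8 + 34.6 - 2000 : ℝ) * (2516 : ℝ)⁻¹ = -(1964.525 / 2516) := by norm_num
    have h4 : (0.3725 : ℝ) / 2 * ((2516 : ℝ) ^ 2)⁻¹ ≤ 0.0000001 := by norm_num
    have h5 : (6.67 : ℝ) * (Real.log 2516 + 1) * (2516 : ℝ)⁻¹ ≤ 0.02341 := by
      rw [← div_eq_mul_inv, div_le_iff₀ (by norm_num)]; nlinarith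
    norm_num at h3 ⊢
    nlinarith
  have h6 : (0.90332 : ℝ) ≤ (1 + Real.log (2 * π)) / π := by
    rw [le_div_iff₀ (by positivity)]; nlinarith
  have h7 : (0.53759 : ℝ) ≤ Real.log (2 * π) ^ 2 / (2 * π) := by
    rw [le_div_iff₀ (by positivity)]; nlinarith
  unfold C1
  linarith

/-! ### The parametrisation and `E⁻` -/

/-- The height `T = 5√x/11`. [cite: Schoenfeld1976, proof of Thm. 10 (choice of T₁)] -/
def Tpar (x : ℝ) : ℝ := Real.sqrt x * (5 / 11)

/-- The bound `log²(T/2π)/(2π) + C₁ ≥ sumInvNorm T` at `T = Tpar x`. [cite: Schoenfeld1976, Lemma 9] -/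
def Abnd (x : ℝ) : ℝ := Real.log (Tpar x / (2 * π)) ^ 2 / (2 * π) + C1

/-- **`E⁻(x) = 5√x/2 + log 2π + √x·Abnd x + (4x/5)·G(Tpar x)`**, the majorant of `x − ψ(x)` (and, up to
lower-order terms, of `ψ(x) − x`) from the differenced explicit formula with `h = 5√x`, `T = 5√x/11`.
[cite: Schoenfeld1976, Thm. 10] -/
def Eminus (x : ℝ) : ℝ :=
  5 * Real.sqrt x / 2 + Real.log (2 * π) + Real.sqrt x * Abnd x + 4 * x / 5 * Gtail (Tpar x)

/-- `log(Tpar x / 2π) = ½ log x + λ₀` and `log(Tpar x) = ½ log x + log(5/11)` (`x > 0`). [folklore] -/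
theorem log_Tpar {x : ℝ} (hx : 0 < x) :
    Real.log (Tpar x / (2 * π)) = Real.log x / 2 + lam0 ∧
      Real.log (Tpar x) = Real.log x / 2 + Real.log (5 / 11) := by
  have hs : 0 < Real.sqrt x := Real.sqrt_pos.2 hx
  have hπ := Real.pi_pos
  have h2 : Real.log (Tpar x) = Real.log x / 2 + Real.log (5 / 11) := by
    unfold Tpar
    rw [Real.log_mul hs.ne' (by norm_num), Real.log_sqrt hx.le]
  refine ⟨?_, h2⟩
  unfold lam0
  rw [Real.log_div (by unfold Tpar; positivity) (by positivity), h2]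
  ring

/-- **The expansion of `E⁻`**: for `x > 0`, with `s = √x`, `ℓ = log x`,
`E⁻(x) = sℓ²/(8π) + (λ₀/(2π) + 11/(25π)) sℓ + (5/2 + λ₀²/(2π) + C₁ + 22(λ₀+1)/(25π)) s
 + 25.82624 ℓ + (log 2π + 3.872·(72.535 + 13.34 log(5/11))) + 5.28850…/s`. [folklore] -/
theorem Eminus_eq {x : ℝ} (hx : 0 < x) :
    Eminus x = Real.sqrt x * Real.log x ^ 2 / (8 * π) +
      (lam0 / (2 * π) + 11 / (25 * π)) * (Real.sqrt x * Real.log x) +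
      (5 / 2 + lam0 ^ 2 / (2 * π) + C1 + 22 * (lam0 + 1) / (25 * π)) * Real.sqrt x +
      (484 / 125 * 6.67) * Real.log x +
      (Real.log (2 * π) + 484 / 125 * (2 * 34.6 + 6.67 / 2 + 2 * 6.67 * Real.log (5 / 11))) +
      (5324 * 0.3725 / 375) / Real.sqrt x := by
  have hs : 0 < Real.sqrt x := Real.sqrt_pos.2 hx
  have hπ := Real.pi_pos
  obtain ⟨h1, h2⟩ := log_Tpar hx
  have hx' : x = Real.sqrt x ^ 2 := (Real.sq_sqrt hx.le).symm
  unfold Eminus Abnd Gtail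
  rw [h1, h2]
  unfold Tpar
  generalize Real.sqrt x = s at hs hx' ⊢
  generalize Real.log x = l
  subst hx'
  field_simp
  ring

/-- **`E⁻(x) ≤ sℓ²/(8π) − 0.2779 sℓ + 3.185 s + 25.83 ℓ + 242 + 5.3/s`** for `x ≥ 1`. [folklore] -/
theorem Eminus_le {x : ℝ} (hx : 1 ≤ x) :
    Eminus x ≤ Real.sqrt x * Real.log x ^ 2 / (8 * π) - 0.2779 * (Real.sqrt x * Real.log x) +
      3.185 * Real.sqrt x + 25.83 * Real.log x + 242 + 5.3 / Real.sqrt x := by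
  have hx0 : 0 < x := by linarith
  have hs : 0 < Real.sqrt x := Real.sqrt_pos.2 hx0
  have hl : 0 ≤ Real.log x := Real.log_nonneg hx
  have hπ := Real.pi_gt_d6
  have hπ' := Real.pi_lt_d6
  obtain ⟨hlam, hlam'⟩ := lam0_bounds
  obtain ⟨hL, hL'⟩ := log_two_pi_bounds
  obtain ⟨h511, h511'⟩ := log_five_elevenths_bounds
  have hC := C1_le
  rw [Eminus_eq hx0]
  -- the coefficients
  have c1 : lam0 / (2 * π) + 11 / (25 * π) ≤ -0.2779 := by
    rw [div_add_div _ _ (by positivity) (by positivity), div_le_iff₀ (by positivity)]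
    nlinarith
  have c2 : 5 / 2 + lam0 ^ 2 / (2 * π) + C1 + 22 * (lam0 + 1) / (25 * π) ≤ 3.185 := by
    have h1 : lam0 ^ 2 / (2 * π) ≤ 1.0988 := by
      rw [div_le_iff₀ (by positivity)]; nlinarith
    have h2 : 22 * (lam0 + 1) / (25 * π) ≤ -0.4555 := by
      rw [div_le_iff₀ (by positivity)]; nlinarith
    linarith
  have c4 : Real.log (2 * π) + 484 / 125 * (2 * 34.6 + 6.67 / 2 + 2 * 6.67 * Real.log (5 / 11)) ≤ 242 := by
    nlinarith
  have c5 : (5324 * 0.3725 / 375 : ℝ) / Real.sqrt x ≤ 5.3 / Real.sqrt x :=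
    div_le_div_of_nonneg_right (by norm_num) hs.le
  have m1 : (lam0 / (2 * π) + 11 / (25 * π)) * (Real.sqrt x * Real.log x) ≤
      -0.2779 * (Real.sqrt x * Real.log x) := mul_le_mul_of_nonneg_right c1 (by positivity)
  have m2 : (5 / 2 + lam0 ^ 2 / (2 * π) + C1 + 22 * (lam0 + 1) / (25 * π)) * Real.sqrt x ≤
      3.185 * Real.sqrt x := mul_le_mul_of_nonneg_right c2 hs.le
  have m3 : (484 / 125 * 6.67 : ℝ) * Real.log x ≤ 25.83 * Real.log x :=
    mul_le_mul_of_nonneg_right (by norm_num) hl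
  linarith

/-! ### The majorant of `ℓ·|∫ (ψ − t) w|` -/

/-- The majorant of `|∫_{10⁴}^x (ψ − t) w|` delivered by `abs_integral_psi_sub_mul_w_le` at `ξ = 10⁴`.
[cite: Schoenfeld1976, proof of Cor. 1] -/
def IpsiB (x : ℝ) : ℝ :=
  Bmaj x * wt x + Bmaj 10000 * wt 10000 +
    2 * nicolasBeta * ((Real.log 10000 ^ 2)⁻¹ + 2 * (Real.log 10000 ^ 3)⁻¹) * (Real.sqrt x - Real.sqrt 10000) +
    (Real.log (2 * π) + (2 * ((10000 : ℝ) ^ 2 - 1))⁻¹) * ((Real.log 10000)⁻¹ + (Real.log 10000 ^ 2)⁻¹)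

/-- `9.21034 < log 10⁴ < 9.210341`. [folklore] -/
theorem log_ten_thousand_bounds : (9.21034 : ℝ) < Real.log 10000 ∧ Real.log 10000 < 9.210341 := by
  rw [show (10000 : ℝ) = 10 ^ 4 by norm_num, Real.log_pow]
  have := log_ten_bounds
  push_cast
  constructor <;> linarith

/-- **`ℓ·IpsiB x ≤ 0.0013256 sℓ + 0.046192 s/ℓ + 0.2975 ℓ + 0.1`** for `x ≥ 10⁸`. [folklore] -/
theorem IpsiB_le {x : ℝ} (hx : (10 : ℝ) ^ 8 ≤ x) :
    Real.log x * IpsiB x ≤ 0.0013256 * (Real.sqrt x * Real.log x) + 0.046192 * (Real.sqrt x / Real.log x) +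
      0.2975 * Real.log x + 0.1 := by
  have hx1 : 1 < x := by linarith [show (1 : ℝ) < 10 ^ 8 by norm_num]
  have hx0 : 0 < x := by linarith
  have hs : 0 < Real.sqrt x := Real.sqrt_pos.2 hx0
  have hs4 : 10000 ≤ Real.sqrt x := by
    rw [show (10000 : ℝ) = Real.sqrt ((10 : ℝ) ^ 8) by
      rw [show ((10 : ℝ) ^ 8) = 10000 ^ 2 by norm_num, Real.sqrt_sq (by norm_num)]]
    exact Real.sqrt_le_sqrt hx
  have hsx : Real.sqrt x * Real.sqrt x = x := Real.mul_self_sqrt hx0.le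
  have hl : 18.42068 ≤ Real.log x := by
    have h := Real.log_le_log (by norm_num) hx
    rw [Real.log_pow] at h
    have := log_ten_bounds.1
    push_cast at h
    linarith
  have hl0 : 0 < Real.log x := by linarith
  obtain ⟨hξ, hξ'⟩ := log_ten_thousand_bounds
  have hβ := nicolasBeta_lt_d8
  have hβ0 : 0 < nicolasBeta := by linarith [nicolasBeta_gt]
  obtain ⟨hL, hL'⟩ := log_two_pi_bounds
  -- (i) `ℓ · B(x) w(x) = β s/ℓ + log 2π/ℓ + 1/(2(x²−1)ℓ) ≤ 0.046192 s/ℓ + 0.1`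
  have h1 : Real.log x * (Bmaj x * wt x) ≤ 0.046192 * (Real.sqrt x / Real.log x) + 0.1 := by
    have e : Real.log x * (Bmaj x * wt x) =
        nicolasBeta * (Real.sqrt x / Real.log x) + (Real.log (2 * π) + (2 * (x ^ 2 - 1))⁻¹) / Real.log x := by
      unfold Bmaj wt
      have hx21 : 2 * (x ^ 2 - 1) ≠ 0 := by nlinarith
      field_simp
      ring
    rw [e]
    have hx2 : (2 * (x ^ 2 - 1))⁻¹ ≤ 0.001 := by
      rw [inv_eq_one_div, div_le_iff₀ (by nlinarith)]; nlinarith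
    have ha : nicolasBeta * (Real.sqrt x / Real.log x) ≤ 0.046192 * (Real.sqrt x / Real.log x) :=
      mul_le_mul_of_nonneg_right (by linarith) (by positivity)
    have hb : (Real.log (2 * π) + (2 * (x ^ 2 - 1))⁻¹) / Real.log x ≤ 0.1 := by
      rw [div_le_iff₀ hl0]; nlinarith
    linarith
  -- (ii) `B(ξ) w(ξ) ≤ 0.0762`
  have h2 : Bmaj 10000 * wt 10000 ≤ 0.0762 := by
    unfold Bmaj wt
    rw [show Real.sqrt 10000 = 100 by rw [show (10000 : ℝ) = 100 ^ 2 by norm_num, Real.sqrt_sq (by norm_num)]]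
    rw [← div_eq_mul_inv, div_le_iff₀ (by positivity)]
    nlinarith
  -- (iii) `2βc_ξ ≤ 0.0013256`
  have h3 : 2 * nicolasBeta * ((Real.log 10000 ^ 2)⁻¹ + 2 * (Real.log 10000 ^ 3)⁻¹) ≤ 0.0013256 := by
    have ha : (Real.log 10000 ^ 2)⁻¹ ≤ 0.0117884 := by
      rw [inv_eq_one_div, div_le_iff₀ (by positivity)]; nlinarith
    have hb : (Real.log 10000 ^ 3)⁻¹ ≤ 0.00127992 := by
      rw [inv_eq_one_div, div_le_iff₀ (by positivity)]; nlinarith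
    nlinarith
  have h3' : 0 ≤ 2 * nicolasBeta * ((Real.log 10000 ^ 2)⁻¹ + 2 * (Real.log 10000 ^ 3)⁻¹) := by positivity
  -- (iv) `(log 2π + ε_ξ) a_ξ ≤ 0.2213`
  have h4 : (Real.log (2 * π) + (2 * ((10000 : ℝ) ^ 2 - 1))⁻¹) * ((Real.log 10000)⁻¹ + (Real.log 10000 ^ 2)⁻¹) ≤ 0.2213 := by
    have ha : (Real.log 10000)⁻¹ ≤ 0.1085737 := by
      rw [inv_eq_one_div, div_le_iff₀ (by positivity)]; nlinarith
    have hb : (Real.log 10000 ^ 2)⁻¹ ≤ 0.0117884 := by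
      rw [inv_eq_one_div, div_le_iff₀ (by positivity)]; nlinarith
    have hc : (2 * ((10000 : ℝ) ^ 2 - 1))⁻¹ ≤ 0.00000001 := by norm_num
    have : 0 ≤ (Real.log 10000)⁻¹ + (Real.log 10000 ^ 2)⁻¹ := by positivity
    nlinarith
  -- assemble
  have hsqrt : Real.sqrt 10000 = 100 := by
    rw [show (10000 : ℝ) = 100 ^ 2 by norm_num, Real.sqrt_sq (by norm_num)]
  unfold IpsiB
  rw [hsqrt]
  have m3 : Real.log x * (2 * nicolasBeta * ((Real.log 10000 ^ 2)⁻¹ + 2 * (Real.log 10000 ^ 3)⁻¹) *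
      (Real.sqrt x - 100)) ≤ 0.0013256 * (Real.sqrt x * Real.log x) := by
    have : Real.log x * (2 * nicolasBeta * ((Real.log 10000 ^ 2)⁻¹ + 2 * (Real.log 10000 ^ 3)⁻¹) *
        (Real.sqrt x - 100)) ≤ Real.log x * (2 * nicolasBeta * ((Real.log 10000 ^ 2)⁻¹ +
          2 * (Real.log 10000 ^ 3)⁻¹) * Real.sqrt x) := by
      refine mul_le_mul_of_nonneg_left (mul_le_mul_of_nonneg_left (by linarith) h3') hl0.le
    have : Real.log x * (2 * nicolasBeta * ((Real.log 10000 ^ 2)⁻¹ + 2 * (Real.log 10000 ^ 3)⁻¹) *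
        Real.sqrt x) ≤ Real.log x * (0.0013256 * Real.sqrt x) :=
      mul_le_mul_of_nonneg_left (mul_le_mul_of_nonneg_right h3 hs.le) hl0.le
    nlinarith
  have m2 : Real.log x * (Bmaj 10000 * wt 10000) ≤ 0.0762 * Real.log x := by nlinarith
  have m4 : Real.log x * ((Real.log (2 * π) + (2 * ((10000 : ℝ) ^ 2 - 1))⁻¹) *
      ((Real.log 10000)⁻¹ + (Real.log 10000 ^ 2)⁻¹)) ≤ 0.2213 * Real.log x := by nlinarith
  nlinarith

/-! ### The majorant of `∫ dt/(√t log² t)` -/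

/-- `g₁(t) = 2√t/log²t + 8√t/log³t`. [folklore] -/
def gOne (t : ℝ) : ℝ := 2 * Real.sqrt t / Real.log t ^ 2 + 8 * Real.sqrt t / Real.log t ^ 3

/-- `g₁'(t) = (1 − 24/log²t)/(√t log²t)` (`t > 1`). [folklore] -/
theorem hasDerivAt_gOne {t : ℝ} (ht : 1 < t) :
    HasDerivAt gOne ((1 - 24 / Real.log t ^ 2) * (Real.sqrt t * Real.log t ^ 2)⁻¹) t := by
  have ht0 : 0 < t := by linarith
  have hl : Real.log t ≠ 0 := (Real.log_pos ht).ne'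
  have hs : 0 < Real.sqrt t := Real.sqrt_pos.2 ht0
  have hsst : Real.sqrt t * Real.sqrt t = t := Real.mul_self_sqrt ht0.le
  have hsq := Real.hasDerivAt_sqrt ht0.ne'
  have hlog := Real.hasDerivAt_log ht0.ne'
  have h := ((hsq.const_mul 2).div (hlog.pow 2) (by simpa using pow_ne_zero 2 hl)).add
    ((hsq.const_mul 8).div (hlog.pow 3) (by simpa using pow_ne_zero 3 hl))
  unfold gOne
  refine h.congr_deriv ?_
  simp only [Pi.pow_apply]
  norm_num
  generalize Real.log t = L at hl ⊢
  generalize Real.sqrt t = u at hs hsst ⊢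
  subst hsst
  field_simp
  ring

/-- `κ(a) = 1 − 24/log²a`. [folklore] -/
def kap (a : ℝ) : ℝ := 1 - 24 / Real.log a ^ 2

/-- **`∫_a^b dt/(√t log² t) ≤ (g₁(b) − g₁(a))/κ(a)`** for `149 ≤ a ≤ b` (`149 ≥ e⁵`; what matters is `log a > √24`):
on `[a, b]`, `1/(√t log²t) = g₁'(t)/(1 − 24/log²t) ≤ g₁'(t)/κ(a)`. [folklore] -/
theorem integral_inv_sqrt_log_sq_le {a b : ℝ} (ha : 149 ≤ a) (hab : a ≤ b) :
    ∫ t in a..b, (Real.sqrt t * Real.log t ^ 2)⁻¹ ≤ (gOne b - gOne a) / kap a := by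
  have ha1 : 1 < a := by linarith
  have hla : 5 ≤ Real.log a := by
    rw [← Real.log_exp 5]
    refine Real.log_le_log (Real.exp_pos 5) (le_trans ?_ ha)
    have he := Real.exp_one_lt_d9
    have h : Real.exp 5 = Real.exp 1 ^ 5 := by rw [← Real.exp_nat_mul]; norm_num
    have h5 : Real.exp 1 ^ 5 < 2.7182818286 ^ 5 := pow_lt_pow_left₀ he (Real.exp_pos 1).le (by norm_num)
    rw [h]; norm_num at h5 ⊢; linarith
  have hκ : 0 < kap a := by
    unfold kap
    have : 24 / Real.log a ^ 2 < 1 := by rw [div_lt_one (by positivity)]; nlinarith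
    linarith
  have hIcc : uIcc a b = Icc a b := uIcc_of_le hab
  -- `g₁(b) − g₁(a) = ∫ g₁'`
  have hderiv : ∀ t ∈ uIcc a b, HasDerivAt gOne ((1 - 24 / Real.log t ^ 2) * (Real.sqrt t * Real.log t ^ 2)⁻¹) t :=
    fun t ht ↦ hasDerivAt_gOne (by rw [hIcc] at ht; exact ha1.trans_le ht.1)
  have hcont' : ContinuousOn (fun t ↦ (1 - 24 / Real.log t ^ 2) * (Real.sqrt t * Real.log t ^ 2)⁻¹) (uIcc a b) := by
    refine continuousOn_of_forall_continuousAt fun t ht ↦ ?_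
    rw [hIcc] at ht
    have ht1 : 1 < t := ha1.trans_le ht.1
    have ht0 : t ≠ 0 := by positivity
    have hl : Real.log t ≠ 0 := (Real.log_pos ht1).ne'
    have hs : Real.sqrt t ≠ 0 := (Real.sqrt_pos.2 (by positivity)).ne'
    have : Real.sqrt t * Real.log t ^ 2 ≠ 0 := by positivity
    have : Real.log t ^ 2 ≠ 0 := by positivity
    fun_prop (disch := assumption)
  have hftc := integral_eq_sub_of_hasDerivAt hderiv hcont'.intervalIntegrable
  have hcont : ContinuousOn (fun t ↦ (Real.sqrt t * Real.log t ^ 2)⁻¹) (Icc a b) := by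
    refine continuousOn_of_forall_continuousAt fun t ht ↦ ?_
    have ht1 : 1 < t := ha1.trans_le ht.1
    have ht0 : t ≠ 0 := by positivity
    have hl : Real.log t ≠ 0 := (Real.log_pos ht1).ne'
    have hs : Real.sqrt t ≠ 0 := (Real.sqrt_pos.2 (by positivity)).ne'
    have : Real.sqrt t * Real.log t ^ 2 ≠ 0 := by positivity
    fun_prop (disch := assumption)
  -- pointwise comparison
  have hpt : ∀ t ∈ Icc a b, (Real.sqrt t * Real.log t ^ 2)⁻¹ ≤
      (kap a)⁻¹ * ((1 - 24 / Real.log t ^ 2) * (Real.sqrt t * Real.log t ^ 2)⁻¹) := by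
    intro t ht
    have ht1 : 1 < t := ha1.trans_le ht.1
    have hlt : Real.log a ≤ Real.log t := Real.log_le_log (by linarith) ht.1
    have hlt0 : 0 < Real.log t := by linarith
    have hw : 0 < (Real.sqrt t * Real.log t ^ 2)⁻¹ := by
      have := Real.sqrt_pos.2 (show 0 < t by linarith); positivity
    have hk : kap a ≤ 1 - 24 / Real.log t ^ 2 := by
      unfold kap
      have : 24 / Real.log t ^ 2 ≤ 24 / Real.log a ^ 2 :=
        div_le_div_of_nonneg_left (by norm_num) (by positivity) (pow_le_pow_left₀ (by linarith) hlt 2)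
      linarith
    rw [← mul_assoc]
    have : 1 ≤ (kap a)⁻¹ * (1 - 24 / Real.log t ^ 2) := by
      rw [inv_mul_eq_div, le_div_iff₀ hκ]; linarith
    nlinarith
  calc ∫ t in a..b, (Real.sqrt t * Real.log t ^ 2)⁻¹
      ≤ ∫ t in a..b, (kap a)⁻¹ * ((1 - 24 / Real.log t ^ 2) * (Real.sqrt t * Real.log t ^ 2)⁻¹) :=
        integral_mono_on hab (hcont.intervalIntegrable_of_Icc hab)
          ((by rwa [hIcc] at hcont' : ContinuousOn _ (Icc a b)).intervalIntegrable_of_Icc hab |>.const_mul _) hpt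
    _ = (gOne b - gOne a) / kap a := by
        rw [intervalIntegral.integral_const_mul, hftc, inv_mul_eq_div]

/-- The bound of `∫_{10⁴}^x dt/(√t log²t)` on three pieces `[10⁴,10⁶]`, `[10⁶,10⁸]`, `[10⁸,x]`.
[cite: Schoenfeld1976, proof of Cor. 1] -/
def Kbnd (x : ℝ) : ℝ :=
  (gOne ((10 : ℝ) ^ 6) - gOne 10000) / kap 10000 + (gOne ((10 : ℝ) ^ 8) - gOne ((10 : ℝ) ^ 6)) / kap ((10 : ℝ) ^ 6) +
    (gOne x - gOne ((10 : ℝ) ^ 8)) / kap ((10 : ℝ) ^ 8)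

/-- **`∫_{10⁴}^x dt/(√t log² t) ≤ Kbnd x`** for `x ≥ 10⁸`. [cite: Schoenfeld1976, proof of Cor. 1] -/
theorem integral_inv_sqrt_log_sq_le_Kbnd {x : ℝ} (hx : (10 : ℝ) ^ 8 ≤ x) :
    ∫ t in (10000 : ℝ)..x, (Real.sqrt t * Real.log t ^ 2)⁻¹ ≤ Kbnd x := by
  have hint : ∀ a b : ℝ, 2 ≤ a → a ≤ b → IntervalIntegrable (fun t ↦ (Real.sqrt t * Real.log t ^ 2)⁻¹) volume a b := by
    intro a b ha hab
    refine ContinuousOn.intervalIntegrable_of_Icc hab (continuousOn_of_forall_continuousAt fun t ht ↦ ?_)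
    have ht1 : 1 < t := by linarith [ht.1]
    have ht0 : t ≠ 0 := by positivity
    have hl : Real.log t ≠ 0 := (Real.log_pos ht1).ne'
    have hs : Real.sqrt t ≠ 0 := (Real.sqrt_pos.2 (by positivity)).ne'
    have : Real.sqrt t * Real.log t ^ 2 ≠ 0 := by positivity
    fun_prop (disch := assumption)
  have h46 : (10000 : ℝ) ≤ 10 ^ 6 := by norm_num
  have h68 : ((10 : ℝ) ^ 6) ≤ 10 ^ 8 := by norm_num
  have e1 := integral_add_adjacent_intervals (hint _ _ (by norm_num) h46) (hint _ _ (by norm_num) (h68.trans hx))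
  have e2 := integral_add_adjacent_intervals (hint _ _ (by norm_num) h68) (hint _ _ (by norm_num) hx)
  have h1 := integral_inv_sqrt_log_sq_le (a := 10000) (b := (10 : ℝ) ^ 6) (by norm_num) h46
  have h2 := integral_inv_sqrt_log_sq_le (a := (10 : ℝ) ^ 6) (b := (10 : ℝ) ^ 8) (by norm_num) h68
  have h3 := integral_inv_sqrt_log_sq_le (a := (10 : ℝ) ^ 8) (b := x) (by norm_num) hx
  generalize (∫ t in (10000 : ℝ)..x, (Real.sqrt t * Real.log t ^ 2)⁻¹) = I4x at e1 ⊢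
  generalize (∫ t in (10000 : ℝ)..(10 : ℝ) ^ 6, (Real.sqrt t * Real.log t ^ 2)⁻¹) = I46 at e1 h1
  generalize (∫ t in ((10 : ℝ) ^ 6)..x, (Real.sqrt t * Real.log t ^ 2)⁻¹) = I6x at e1 e2
  generalize (∫ t in ((10 : ℝ) ^ 6)..(10 : ℝ) ^ 8, (Real.sqrt t * Real.log t ^ 2)⁻¹) = I68 at e2 h2
  generalize (∫ t in ((10 : ℝ) ^ 8)..x, (Real.sqrt t * Real.log t ^ 2)⁻¹) = I8x at e2 h3
  unfold Kbnd
  linarith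

/-- **`1.33 ℓ·Kbnd x ≤ 5.72 ℓ + 2.865 s/ℓ + 11.46 s/ℓ²`** for `x ≥ 10⁸` (`ℓ g₁(x) = 2s/ℓ + 8s/ℓ²`,
`1/κ(10⁸) ≤ 1.077`, and the constant part of `Kbnd` is `≤ 4.3`: `14.37 + 66.94 − 77.04`). [folklore] -/
theorem Kbnd_le {x : ℝ} (hx : (10 : ℝ) ^ 8 ≤ x) :
    1.33 * (Real.log x * Kbnd x) ≤ 5.72 * Real.log x + 2.865 * (Real.sqrt x / Real.log x) +
      11.46 * (Real.sqrt x / Real.log x ^ 2) := by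
  have hx1 : 1 < x := by linarith [show (1 : ℝ) < 10 ^ 8 by norm_num]
  have hx0 : 0 < x := by linarith
  have hs : 0 < Real.sqrt x := Real.sqrt_pos.2 hx0
  obtain ⟨h10, h10'⟩ := log_ten_bounds
  have hl4 : Real.log 10000 = 4 * Real.log 10 := by
    rw [show (10000 : ℝ) = 10 ^ 4 by norm_num, Real.log_pow]; push_cast; ring
  have hl6 : Real.log ((10 : ℝ) ^ 6) = 6 * Real.log 10 := by rw [Real.log_pow]; push_cast; ring
  have hl8 : Real.log ((10 : ℝ) ^ 8) = 8 * Real.log 10 := by rw [Real.log_pow]; push_cast; ring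
  have hs4 : Real.sqrt 10000 = 100 := by
    rw [show (10000 : ℝ) = 100 ^ 2 by norm_num, Real.sqrt_sq (by norm_num)]
  have hs6 : Real.sqrt ((10 : ℝ) ^ 6) = 1000 := by
    rw [show ((10 : ℝ) ^ 6) = 1000 ^ 2 by norm_num, Real.sqrt_sq (by norm_num)]
  have hs8 : Real.sqrt ((10 : ℝ) ^ 8) = 10000 := by
    rw [show ((10 : ℝ) ^ 8) = 10000 ^ 2 by norm_num, Real.sqrt_sq (by norm_num)]
  have hl : 18.42068 ≤ Real.log x := by
    have h := Real.log_le_log (by norm_num) hx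
    rw [hl8] at h; linarith
  have hl0 : 0 < Real.log x := by linarith
  set L := Real.log 10 with hL
  -- numerical values of `g₁` and `κ` at the three break points (crude)
  have hg4 : 3.3 ≤ gOne 10000 := by
    unfold gOne; rw [hs4, hl4]
    have ha : (2.35 : ℝ) ≤ 2 * 100 / (4 * L) ^ 2 := by rw [le_div_iff₀ (by positivity)]; nlinarith
    have hb : (1.02 : ℝ) ≤ 8 * 100 / (4 * L) ^ 3 := by rw [le_div_iff₀ (by positivity)]; nlinarith
    linarith
  have hg6 : 13.4 ≤ gOne ((10 : ℝ) ^ 6) ∧ gOne ((10 : ℝ) ^ 6) ≤ 13.6 := by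
    unfold gOne; rw [hs6, hl6]
    have ha : (10.47 : ℝ) ≤ 2 * 1000 / (6 * L) ^ 2 := by rw [le_div_iff₀ (by positivity)]; nlinarith
    have ha' : 2 * 1000 / (6 * L) ^ 2 ≤ (10.48 : ℝ) := by rw [div_le_iff₀ (by positivity)]; nlinarith
    have hb : (3.03 : ℝ) ≤ 8 * 1000 / (6 * L) ^ 3 := by rw [le_div_iff₀ (by positivity)]; nlinarith
    have hb' : 8 * 1000 / (6 * L) ^ 3 ≤ (3.04 : ℝ) := by rw [div_le_iff₀ (by positivity)]; nlinarith
    constructor <;> linarith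
  have hg8 : 71.6 ≤ gOne ((10 : ℝ) ^ 8) ∧ gOne ((10 : ℝ) ^ 8) ≤ 71.9 := by
    unfold gOne; rw [hs8, hl8]
    have ha : (58.9 : ℝ) ≤ 2 * 10000 / (8 * L) ^ 2 := by rw [le_div_iff₀ (by positivity)]; nlinarith
    have ha' : 2 * 10000 / (8 * L) ^ 2 ≤ (58.95 : ℝ) := by rw [div_le_iff₀ (by positivity)]; nlinarith
    have hb : (12.79 : ℝ) ≤ 8 * 10000 / (8 * L) ^ 3 := by rw [le_div_iff₀ (by positivity)]; nlinarith
    have hb' : 8 * 10000 / (8 * L) ^ 3 ≤ (12.81 : ℝ) := by rw [div_le_iff₀ (by positivity)]; nlinarith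
    constructor <;> linarith
  have hk4 : 0.717 ≤ kap 10000 := by
    unfold kap; rw [hl4]
    have : 24 / (4 * L) ^ 2 ≤ (0.283 : ℝ) := by rw [div_le_iff₀ (by positivity)]; nlinarith
    linarith
  have hk6 : 0.874 ≤ kap ((10 : ℝ) ^ 6) := by
    unfold kap; rw [hl6]
    have : 24 / (6 * L) ^ 2 ≤ (0.126 : ℝ) := by rw [div_le_iff₀ (by positivity)]; nlinarith
    linarith
  have hk8 : 0.929 ≤ kap ((10 : ℝ) ^ 8) ∧ kap ((10 : ℝ) ^ 8) ≤ 0.929272 := by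
    unfold kap; rw [hl8]
    have : 24 / (8 * L) ^ 2 ≤ (0.071 : ℝ) := by rw [div_le_iff₀ (by positivity)]; nlinarith
    have : (0.0707293 : ℝ) ≤ 24 / (8 * L) ^ 2 := by rw [le_div_iff₀ (by positivity)]; nlinarith
    constructor <;> linarith
  -- the constant pieces: `≤ 4.3`
  -- make the six numerical atoms opaque (no unfolding of `√`/`log` at literals in the arithmetic)
  have hgx : Real.log x * gOne x = 2 * (Real.sqrt x / Real.log x) + 8 * (Real.sqrt x / Real.log x ^ 2) := by
    unfold gOne; field_simp
  unfold Kbnd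
  generalize gOne 10000 = g4 at hg4 ⊢
  generalize gOne ((10 : ℝ) ^ 6) = g6 at hg6 ⊢
  generalize gOne ((10 : ℝ) ^ 8) = g8 at hg8 ⊢
  generalize kap 10000 = k4 at hk4 ⊢
  generalize kap ((10 : ℝ) ^ 6) = k6 at hk6 ⊢
  generalize kap ((10 : ℝ) ^ 8) = k8 at hk8 ⊢
  clear hs4 hs6 hs8 hl4 hl6 hl8 h10 h10' hL L
  have hk4p : 0 < k4 := by linarith only [hk4]
  have hk6p : 0 < k6 := by linarith only [hk6]
  have hk8p : 0 < k8 := by linarith only [hk8.1]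
  have hA : (g6 - g4) / k4 ≤ 14.37 := by
    rw [div_le_iff₀ hk4p]
    have := mul_le_mul_of_nonneg_left hk4 (by norm_num : (0 : ℝ) ≤ 14.37)
    linarith [hg6.2]
  have hB : (g8 - g6) / k6 ≤ 66.94 := by
    rw [div_le_iff₀ hk6p]
    have := mul_le_mul_of_nonneg_left hk6 (by norm_num : (0 : ℝ) ≤ 66.94)
    linarith [hg8.2, hg6.1]
  have hC : -g8 / k8 ≤ -77.04 := by
    rw [div_le_iff₀ hk8p]
    have := mul_le_mul_of_nonneg_left hk8.2 (by norm_num : (0 : ℝ) ≤ 77.04)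
    linarith [hg8.1]
  -- the `x`-dependent piece: `ℓ g₁(x)/κ₈ ≤ 1.077 (2s/ℓ + 8s/ℓ²)`
  have hgx0 : 0 ≤ Real.log x * gOne x := by rw [hgx]; positivity
  have hD : Real.log x * gOne x / k8 ≤ 1.077 * (Real.log x * gOne x) := by
    rw [div_le_iff₀ hk8p]
    have := mul_le_mul_of_nonneg_left hk8.1 (by positivity : (0 : ℝ) ≤ 1.077 * (Real.log x * gOne x))
    linarith only [this, hgx0]
  have e : Real.log x * ((g6 - g4) / k4 + (g8 - g6) / k6 + (gOne x - g8) / k8) =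
      Real.log x * ((g6 - g4) / k4 + (g8 - g6) / k6 + -g8 / k8) + Real.log x * gOne x / k8 := by ring
  have hsum : (g6 - g4) / k4 + (g8 - g6) / k6 + -g8 / k8 ≤ 4.3 := by linarith only [hA, hB, hC]
  rw [e, hgx]
  rw [hgx] at hD hgx0
  have hconst : Real.log x * ((g6 - g4) / k4 + (g8 - g6) / k6 + -g8 / k8) ≤ Real.log x * 4.3 :=
    mul_le_mul_of_nonneg_left hsum hl0.le
  have hpos1 : 0 ≤ Real.sqrt x / Real.log x := div_nonneg hs.le hl0.le
  have hpos2 : 0 ≤ Real.sqrt x / Real.log x ^ 2 := div_nonneg hs.le (pow_nonneg hl0.le 2)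
  linarith only [hD, hconst, hpos1, hpos2, hl0]

/-! ### `ℓ/s` is non-increasing and the final inequality -/

/-- `log x/√x ≤ log a/√a` for `8 ≤ a ≤ x`: Mathlib's `Real.log_div_sqrt_antitoneOn` (antitone on `[e², ∞)`,
`e² < 7.39 ≤ 8`). [folklore] -/
theorem log_div_sqrt_le {a x : ℝ} (ha : 8 ≤ a) (hax : a ≤ x) :
    Real.log x / Real.sqrt x ≤ Real.log a / Real.sqrt a := by
  have he : Real.exp 2 ≤ a := by
    have h : Real.exp 2 = Real.exp 1 ^ 2 := by rw [← Real.exp_nat_mul]; norm_num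
    have h2 : Real.exp 1 ^ 2 < 2.7182818286 ^ 2 :=
      pow_lt_pow_left₀ Real.exp_one_lt_d9 (Real.exp_pos 1).le (by norm_num)
    rw [h]; norm_num at h2 ⊢; linarith
  exact Real.log_div_sqrt_antitoneOn (Set.mem_Ici.2 he) (Set.mem_Ici.2 (he.trans hax)) hax

/-- **The final inequality on `[10⁸, ∞)`**:
`E⁻(x) + 1.0925 √x + log x·(IpsiB x + 1.33 Kbnd x + 25/π) < √x log² x/(8π)` for `x ≥ 10⁸`.
[cite: Schoenfeld1976, Cor. 1 (6.18) (the analytic range)] -/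
theorem key_ineq {x : ℝ} (hx : (10 : ℝ) ^ 8 ≤ x) :
    Eminus x + 1.0925 * Real.sqrt x + Real.log x * (IpsiB x + 1.33 * Kbnd x + 25 / π) <
      Real.sqrt x * Real.log x ^ 2 / (8 * π) := by
  have hx1 : 1 < x := by linarith [show (1 : ℝ) < 10 ^ 8 by norm_num]
  have hx0 : 0 < x := by linarith
  have hs : 0 < Real.sqrt x := Real.sqrt_pos.2 hx0
  have hs8 : Real.sqrt ((10 : ℝ) ^ 8) = 10000 := by
    rw [show ((10 : ℝ) ^ 8) = 10000 ^ 2 by norm_num, Real.sqrt_sq (by norm_num)]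
  have hs4 : 10000 ≤ Real.sqrt x := by rw [← hs8]; exact Real.sqrt_le_sqrt hx
  obtain ⟨h10, h10'⟩ := log_ten_bounds
  have hl8 : Real.log ((10 : ℝ) ^ 8) = 8 * Real.log 10 := by rw [Real.log_pow]; push_cast; ring
  have hl : 18.42068 ≤ Real.log x := by
    have h := Real.log_le_log (by norm_num) hx
    rw [hl8] at h; linarith
  have hl0 : 0 < Real.log x := by linarith
  have hπ := Real.pi_gt_d6
  -- the four majorants
  have hA := Eminus_le hx1.le
  have hC := IpsiB_le hx
  have hD := Kbnd_le hx
  have hE : Real.log x * (25 / π) ≤ 7.958 * Real.log x := by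
    have : 25 / π ≤ 7.958 := by rw [div_le_iff₀ Real.pi_pos]; nlinarith
    nlinarith
  -- `ℓ/s ≤ 0.00184207`
  have hls : Real.log x / Real.sqrt x ≤ 0.00184207 := by
    have h := log_div_sqrt_le (a := (10 : ℝ) ^ 8) (by norm_num) hx
    rw [hs8, hl8] at h
    have : 8 * Real.log 10 / 10000 ≤ (0.00184207 : ℝ) := by
      rw [div_le_iff₀ (by norm_num)]; linarith
    linarith
  have hls' : Real.log x ≤ 0.00184207 * Real.sqrt x := by rwa [div_le_iff₀ hs] at hls
  -- the terms in `s/ℓ`, `s/ℓ²`, `1/s`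
  have hq1 : Real.sqrt x / Real.log x ≤ Real.sqrt x / 18.42068 :=
    div_le_div_of_nonneg_left hs.le (by norm_num) hl
  have hq2 : Real.sqrt x / Real.log x ^ 2 ≤ Real.sqrt x / 18.42068 ^ 2 :=
    div_le_div_of_nonneg_left hs.le (by norm_num) (pow_le_pow_left₀ (by norm_num) hl 2)
  have hq3 : 5.3 / Real.sqrt x ≤ 5.3 / 10000 := div_le_div_of_nonneg_left (by norm_num) (by norm_num) hs4
  have hmain : 0.2779 * (Real.sqrt x * Real.log x) - 0.0013256 * (Real.sqrt x * Real.log x) ≥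
      5.09468 * Real.sqrt x := by
    have := mul_le_mul_of_nonneg_left hl hs.le
    linarith
  have expand : Real.log x * (IpsiB x + 1.33 * Kbnd x + 25 / π) =
      Real.log x * IpsiB x + 1.33 * (Real.log x * Kbnd x) + Real.log x * (25 / π) := by ring
  rw [expand]
  -- collect the lower-order terms against `√x`
  have step2 : (0.046192 + 2.865) * (Real.sqrt x / Real.log x) ≤ 0.158041 * Real.sqrt x := by
    have : Real.sqrt x / 18.42068 ≤ 0.0542869 * Real.sqrt x := by
      rw [div_le_iff₀ (by norm_num)]; linarith
    linarith
  have step3 : 11.46 * (Real.sqrt x / Real.log x ^ 2) ≤ 0.033774 * Real.sqrt x := by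
    have : Real.sqrt x / 18.42068 ^ 2 ≤ 0.0029471 * Real.sqrt x := by
      rw [div_le_iff₀ (by norm_num)]; linarith
    linarith
  have step4 : (25.83 + 0.2975 + 5.72 + 7.958) * Real.log x ≤ 0.073325 * Real.sqrt x := by linarith
  have step5 : 242 + 0.1 + 5.3 / Real.sqrt x ≤ 0.024211 * Real.sqrt x := by linarith
  linarith

/-! ### The lower-order terms of the upper bound -/

/-- `log² x ≤ 4√x` for `x ≥ 1` (with `y = x^{1/4}`: `2 log y ≤ y`, as `log(y/2) ≤ y/2 − 1`, `log 2 ≤ 1`). [folklore] -/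
theorem log_sq_le_four_sqrt {x : ℝ} (hx : 1 ≤ x) : Real.log x ^ 2 ≤ 4 * Real.sqrt x := by
  have hx0 : 0 < x := by linarith
  set y : ℝ := Real.sqrt (Real.sqrt x) with hy
  have hs0 : 0 < Real.sqrt x := Real.sqrt_pos.2 hx0
  have hy0 : 0 < y := Real.sqrt_pos.2 hs0
  have hy2 : y ^ 2 = Real.sqrt x := Real.sq_sqrt hs0.le
  have hlogx : Real.log x = 4 * Real.log y := by
    have h1 : Real.log (Real.sqrt x) = Real.log x / 2 := Real.log_sqrt hx0.le
    have h2 : Real.log y = Real.log (Real.sqrt x) / 2 := Real.log_sqrt hs0.le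
    linarith
  have hlogy : Real.log y ≤ y / 2 := by
    have h := Real.log_le_sub_one_of_pos (show 0 < y / 2 by positivity)
    rw [Real.log_div hy0.ne' two_ne_zero] at h
    have := Real.log_two_lt_d9
    linarith
  have hlogy0 : 0 ≤ Real.log y := by
    refine Real.log_nonneg ?_
    rw [hy, Real.le_sqrt (by norm_num) hs0.le, one_pow, Real.le_sqrt (by norm_num) hx0.le]
    simpa using hx
  rw [hlogx, ← hy2]
  nlinarith

/-- **`2.5·Abnd x + 6.4 √x·G(Tpar x) + 1 ≤ 0.41 √x`** for `x ≥ 10⁸`: the extra lower-order terms of the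
majorant of `ψ(x) − x` (from `√(x+h)`, `(x+h)^{3/2}`) are absorbed by the slack of `key_ineq`. [folklore] -/
theorem aux_upper {x : ℝ} (hx : (10 : ℝ) ^ 8 ≤ x) :
    2.5 * Abnd x + 6.4 * Real.sqrt x * Gtail (Tpar x) + 1 ≤ 0.41 * Real.sqrt x := by
  have hx1 : 1 < x := by linarith [show (1 : ℝ) < 10 ^ 8 by norm_num]
  have hx0 : 0 < x := by linarith
  have hs : 0 < Real.sqrt x := Real.sqrt_pos.2 hx0
  have hs8 : Real.sqrt ((10 : ℝ) ^ 8) = 10000 := by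
    rw [show ((10 : ℝ) ^ 8) = 10000 ^ 2 by norm_num, Real.sqrt_sq (by norm_num)]
  have hs4 : 10000 ≤ Real.sqrt x := by rw [← hs8]; exact Real.sqrt_le_sqrt hx
  obtain ⟨h10, h10'⟩ := log_ten_bounds
  have hl8 : Real.log ((10 : ℝ) ^ 8) = 8 * Real.log 10 := by rw [Real.log_pow]; push_cast; ring
  have hl : 18.42068 ≤ Real.log x := by
    have h := Real.log_le_log (by norm_num) hx
    rw [hl8] at h; linarith
  have hπ := Real.pi_gt_d6
  have hπ' := Real.pi_lt_d6
  obtain ⟨hlam, hlam'⟩ := lam0_bounds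
  obtain ⟨h511, h511'⟩ := log_five_elevenths_bounds
  have hC := C1_le
  have hls' : Real.log x ≤ 0.00184207 * Real.sqrt x := by
    have h := log_div_sqrt_le (a := (10 : ℝ) ^ 8) (by norm_num) hx
    rw [hs8, hl8] at h
    have h' : 8 * Real.log 10 / 10000 ≤ (0.00184207 : ℝ) := by
      rw [div_le_iff₀ (by norm_num)]; linarith
    have h'' : Real.log x / Real.sqrt x ≤ 0.00184207 := h.trans h'
    rwa [div_le_iff₀ hs] at h''
  have hl2 := log_sq_le_four_sqrt hx1.le
  obtain ⟨e1, e2⟩ := log_Tpar hx0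
  clear hs8 hl8 h10 h10'
  -- `Abnd x ≤ ℓ²/(8π) + 0.041`
  have hA : Abnd x ≤ Real.log x ^ 2 / (8 * π) + 0.041 := by
    unfold Abnd
    rw [e1]
    have hsq : (Real.log x / 2 + lam0) ^ 2 ≤ (Real.log x / 2) ^ 2 := by nlinarith
    have : (Real.log x / 2 + lam0) ^ 2 / (2 * π) ≤ (Real.log x / 2) ^ 2 / (2 * π) :=
      div_le_div_of_nonneg_right hsq (by positivity)
    have e : (Real.log x / 2) ^ 2 / (2 * π) = Real.log x ^ 2 / (8 * π) := by ring
    linarith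
  -- `√x · G(T) ≤ 0.1784 ℓ + 0.031`
  have hG : Real.sqrt x * Gtail (Tpar x) =
      11 / (10 * π) * (Real.log x / 2 + lam0 + 1) +
        121 / (25 * Real.sqrt x) * (2 * 34.6 + 6.67 / 2 + 2 * 6.67 * (Real.log x / 2 + Real.log (5 / 11))) +
        5 * 0.3725 * 1331 / (3 * 125 * Real.sqrt x ^ 2) := by
    unfold Gtail
    rw [e1, e2]
    unfold Tpar
    field_simp
    ring
  have hG' : Real.sqrt x * Gtail (Tpar x) ≤ 0.1784 * Real.log x + 0.031 := by
    rw [hG]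
    have t1 : 11 / (10 * π) * (Real.log x / 2 + lam0 + 1) ≤ 0.17508 * Real.log x - 0.5693 := by
      have hc : 11 / (10 * π) ≤ 0.350142 := by rw [div_le_iff₀ (by positivity)]; linarith
      have hpos : 0 ≤ Real.log x / 2 + lam0 + 1 := by linarith
      have := mul_le_mul_of_nonneg_right hc hpos
      linarith
    have t2 : 121 / (25 * Real.sqrt x) * (2 * 34.6 + 6.67 / 2 + 2 * 6.67 * (Real.log x / 2 + Real.log (5 / 11))) ≤
        0.000484 * (62.1 + 6.67 * Real.log x) := by
      have hc : 121 / (25 * Real.sqrt x) ≤ 0.000484 := by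
        rw [div_le_iff₀ (by positivity)]; linarith
      have hb : 2 * 34.6 + 6.67 / 2 + 2 * 6.67 * (Real.log x / 2 + Real.log (5 / 11)) ≤ 62.1 + 6.67 * Real.log x := by
        linarith
      have hb0 : 0 ≤ 2 * 34.6 + 6.67 / 2 + 2 * 6.67 * (Real.log x / 2 + Real.log (5 / 11)) := by linarith
      calc 121 / (25 * Real.sqrt x) * (2 * 34.6 + 6.67 / 2 + 2 * 6.67 * (Real.log x / 2 + Real.log (5 / 11)))
          ≤ 0.000484 * (2 * 34.6 + 6.67 / 2 + 2 * 6.67 * (Real.log x / 2 + Real.log (5 / 11))) :=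
            mul_le_mul_of_nonneg_right hc hb0
        _ ≤ 0.000484 * (62.1 + 6.67 * Real.log x) := mul_le_mul_of_nonneg_left hb (by norm_num)
    have t3 : 5 * 0.3725 * 1331 / (3 * 125 * Real.sqrt x ^ 2) ≤ 0.0001 := by
      rw [div_le_iff₀ (by positivity)]
      have := mul_le_mul hs4 hs4 (by norm_num) hs.le
      nlinarith
    linarith
  have hGpos : 0 ≤ 6.4 * Real.sqrt x := by positivity
  have h64 : 6.4 * Real.sqrt x * Gtail (Tpar x) ≤ 6.4 * (0.1784 * Real.log x + 0.031) := by
    have := mul_le_mul_of_nonneg_left hG' (by norm_num : (0 : ℝ) ≤ 6.4)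
    linarith [this]
  have hπ8 : Real.log x ^ 2 / (8 * π) ≤ 0.0398 * Real.log x ^ 2 := by
    rw [div_le_iff₀ (by positivity)]
    have : 0 ≤ Real.log x ^ 2 := sq_nonneg _
    nlinarith
  linarith only [hA, h64, hπ8, hl2, hls', hs4]

/-- `Kbnd x ≥ 0` for `x ≥ 10⁸` (it bounds a non-negative integral). [folklore] -/
theorem Kbnd_nonneg {x : ℝ} (hx : (10 : ℝ) ^ 8 ≤ x) : 0 ≤ Kbnd x := by
  refine le_trans (intervalIntegral.integral_nonneg (by linarith [show (10000 : ℝ) ≤ 10 ^ 8 by norm_num])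
    fun t ht ↦ ?_) (integral_inv_sqrt_log_sq_le_Kbnd hx)
  have : 0 < Real.sqrt t := Real.sqrt_pos.2 (by linarith [ht.1])
  have : 0 < Real.log t := Real.log_pos (by linarith [ht.1])
  positivity

end SchoenfeldBound

end Literature.NumberTheory.LFunctions

end
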